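import Literature.NumberTheory.GaloisRepresentations.MonomialTwist
import HarnessLib

/-!
# Serre's trick for the Artin lift of a residually dihedral representation: an ODD lift with
# the same reduction and the same local shape (Allen 2014, Lemma 87), modulo the existence of
# the twisting character

Theorems only (no definition of a notion, no named fact; D-0026), written by the seat of the
named fact `Literature.NumberTheory.Automorphic.Allen2014_modularity_nearlyOrdinaryDihedral_Q`
(P. B. Allen, Compositio Math. 150 (2014) = arXiv:1301.1113).  It assembles
`TeichmullerLiftMonomial` (the Teichmüller/Artin lift `ρ₁ = Ind χ` of `ρ̄ = Ind χ̄`),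
`TeichmullerLiftLocalShape` (`ρ₁|_{G_v} ≅ χ'_v ⊕ χ_v`) and `MonomialTwist` (the twist
`Ind χ ↦ Ind (χ ξ)` in matrix form) into the Galois-theoretic content of Serre's trick in the
proof of Allen's Lemma 87 (OrdinaryLift), arXiv:1301.1113 p. 70, for `p = 2`:

> "If there is some choice of complex conjugation at which `ρ̄` is trivial, we use a trick of
> Serre. […] By [ArtinTate, X Theorem 5], there is a character `ξ : G_L → ℚ̄ˣ` of order either
> two or four, such that `ξ` [is] nontrivial at each `{σ₁, …, σ_k}` and trivial at each
> `{σ'₁, …, σ'_k}` as well as at every place above `2`. […] We set `ρ₁ = Ind_{G_L}^{G_F} χ ξ`.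
> Since `ξ` has order two or four, it is trivial mod `2`, and `ρ₁` is a lift of `ρ̄`.  By
> choice of `ξ`, the lift `ρ₁` is totally odd.  Also, because `ξ` is trivial at any place above
> `2` we have `ρ₁|_{G_v} ≅ (χ'_v 0 ; 0 χ_v)`."

The EXISTENCE of `ξ` ([Artin–Tate, Ch. X, Thm. 5] = Grunwald–Wang for the quadratic extension
`L = K̄^{Hm}` cut out by `ρ̄`, with prescribed components at the real places and at the places
above `2`) is the number-theoretic input of the trick; it is NOT proved here but enters the
final assembly `FramedGaloisRep.exists_odd_artinLift_diagonal_of_isSolvable_two_of_exists_twistChar`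
as the explicit hypothesis `hAT`, stated on the absolute Galois group: for the open index-two
subgroup `Hm ≤ Γ_K` on which `ρ̄` is diagonal and a coset representative `c₀`, a function
`ξ : Γ_K → ℤ̄₂` multiplicative on `Hm`, of finite order and `≡ 1 (mod 𝔪)` there, locally
constant, with `ξ(c) ξ(c₀⁻¹ c c₀) = -1` at every complex conjugation `c ∈ Hm` (nontrivial at
exactly one of the two real places of `L` above each real place of `K` split in `L`) and trivial
on the decomposition groups above the chosen place `v` (and their `c₀`-conjugates).

## Main results (all proved)

* `exists_teichmullerLift_of_isDihedralType_subgroup` — the Teichmüller lift of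
  `TeichmullerLiftLocalShape` together with its DIAGONAL SUBGROUP `Hm` (index two, containing
  `ker ρ̄`, `ρ₁` diagonal on `Hm` and antidiagonal off `Hm`) and a coset representative.
* `FramedGaloisRep.det_eq_neg_one_of_isReductionOf_ne_one_two` — at `p = 2`, a continuous
  `ρ₁ : Γ_K → GL₂(ℚ̄₂)` with a reduction `τ` has `det ρ₁(c) = -1` at every complex conjugation
  `c` with `τ(c) ≠ 1` (the per-conjugation form of
  `FramedGaloisRep.isOdd_of_isReductionOf_ne_one_two`).
* `FramedGaloisRep.exists_twist_artinLift` — the twist of an integral Artin representation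
  `ρ₀ : Γ_K → GL₂(ℤ̄_p)`, monomial with respect to `(Hm, c₀)`, by a locally constant `ξ` as
  above: again a continuous Artin representation, with the same reduction when
  `ξ ≡ 1 (mod 𝔪)`, root-of-unity entries, `det = ξ(h) ξ(c₀⁻¹ h c₀) det ρ₀(h)` on `Hm`, and
  EQUAL to `ρ₀` on the decomposition group at any finite place where `ξ` is trivial.
* `FramedGaloisRep.exists_odd_artinLift_diagonal_of_isSolvable_two_of_exists_twistChar` —
  **Allen's Lemma 87, Galois side, at `p = 2` over a number field `K`, modulo `hAT`**: for
  `ρ : Γ_K → GL₂(ℚ̄₂)` residually absolutely irreducible with solvable residual image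
  (hypothesis (4)) and a finite place `v` with a triangular form `(χ̄'_v ∗ ; 0 χ̄_v)` of
  `ρ̄|_{Γ_{K_v}}` (e.g. from hypothesis (2), `ResiduallyReducibleOfStableLine`), there is an ODD
  continuous Artin lift `ρ₁` of `ρ̄ = ρ.residualRep` with integral model, open kernel,
  root-of-unity entries, and `ρ₁|_{Γ_{K_v}} ≅ χ'_v ⊕ χ_v` with `χ'_v, χ_v : Γ_{K_v} → ℤ̄₂`
  continuous of finite order lifting `χ̄'_v, χ̄_v`.

## References

* P. B. Allen, Compositio Math. 150 (2014) 1235–1346, Lemma 87 (= arXiv:1301.1113, §5.1.1,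
  pp. 69–70). [Allen2014]
* E. Artin, J. Tate, *Class Field Theory*, Ch. X, Thm. 5 (Grunwald–Wang). [ArtinTate]
* J.-P. Serre, *Modular forms of weight one and Galois representations* (Durham 1975),
  Academic Press (1977), §8. [Serre1977WeightOne]
-/

noncomputable section

open scoped MatrixGroups NumberField
open Matrix IsLocalRing IsDedekindDomain

namespace Literature.NumberTheory.GaloisRepresentations

variable {p : ℕ} [Fact p.Prime]

/-! ### The diagonal subgroup of the Teichmüller lift -/

section DiagonalSubgroup

variable {G : Type*} [Group G]

/-- **The Teichmüller lift of an irreducible representation of dihedral type, with its diagonal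
subgroup** (`Hm = G_L` in Allen's notation, `ρ̄ = Ind_{G_L}^{G_F} χ̄`): the lift `ρ₁` of
`exists_teichmullerLift_of_isDihedralType_shape` together with the subgroup `Hm` of the `g`
with `ρ₁(g) mod 𝔪` diagonal — of index two (the product of two elements off `Hm` lies in `Hm`,
and some `c₀ ∉ Hm`), containing `ker ρ̄`, with `ρ₁(h)` diagonal for `h ∈ Hm` and antidiagonal
for `g ∉ Hm` (over `ℤ̄_p`, not only modulo `𝔪`).
[cite: Allen2014, Lemma 87 (arXiv:1301.1113, §5.1.1, p. 70)] -/
theorem exists_teichmullerLift_of_isDihedralType_subgroup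
    (τ : G →* GL (Fin 2) (padicAlgClResidueField p))
    [Finite τ.range] (hce : ¬ HasCommonEigenvector τ) (hτ : IsDihedralType τ) :
    ∃ (ρ₁ : G →* GL (Fin 2) (padicAlgClIntegers p)) (Q : GL (Fin 2) (padicAlgClResidueField p))
      (n : ℕ) (Hm : Subgroup G) (c₀ : G), 0 < n ∧ ¬ p ∣ n ∧ ρ₁.ker = τ.ker ∧
      (∀ g, τ g = Q * integralReduction (RingHom.id _) ρ₁ g * Q⁻¹) ∧
      (∀ g i j, (ρ₁ g).val i j = 0 ∨ ((ρ₁ g).val i j : PadicAlgCl p) ^ n = 1) ∧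
      (∀ g, GL2.IsDg (integralReduction (RingHom.id _) ρ₁ g).val ∨
        GL2.IsAd (integralReduction (RingHom.id _) ρ₁ g).val) ∧
      c₀ ∉ Hm ∧ (∀ g g', g ∉ Hm → g' ∉ Hm → g * g' ∈ Hm) ∧ τ.ker ≤ Hm ∧
      (∀ g, g ∈ Hm ↔ GL2.IsDg (integralReduction (RingHom.id _) ρ₁ g).val) ∧
      (∀ h ∈ Hm, (ρ₁ h).val 0 1 = 0 ∧ (ρ₁ h).val 1 0 = 0) ∧
      (∀ g ∉ Hm, (ρ₁ g).val 0 0 = 0 ∧ (ρ₁ g).val 1 1 = 0) := by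
  obtain ⟨ρ₁, Q, n, hn0, hn, hker, hQ, hroots, hshape⟩ :=
    exists_teichmullerLift_of_isDihedralType_shape τ hce hτ
  -- shapes are stable under products
  have hdet : ∀ g, (integralReduction (RingHom.id _) ρ₁ g).val 0 0 *
      (integralReduction (RingHom.id _) ρ₁ g).val 1 1 -
      (integralReduction (RingHom.id _) ρ₁ g).val 0 1 *
      (integralReduction (RingHom.id _) ρ₁ g).val 1 0 ≠ 0 := fun g => by
    have h := (integralReduction (RingHom.id _) ρ₁ g).isUnit.map Matrix.detMonoidHom
    rw [Matrix.coe_detMonoidHom, Matrix.det_fin_two] at h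
    exact h.ne_zero
  have hDgDg : ∀ A B : Matrix (Fin 2) (Fin 2) (padicAlgClResidueField p),
      GL2.IsDg A → GL2.IsDg B → GL2.IsDg (A * B) := fun A B hA hB =>
    ⟨by rw [Matrix.mul_apply, Fin.sum_univ_two, hA.1, hB.1, mul_zero, zero_mul, add_zero],
      by rw [Matrix.mul_apply, Fin.sum_univ_two, hA.2, hB.2, mul_zero, zero_mul, add_zero]⟩
  have hAdAd : ∀ A B : Matrix (Fin 2) (Fin 2) (padicAlgClResidueField p),
      GL2.IsAd A → GL2.IsAd B → GL2.IsDg (A * B) := fun A B hA hB =>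
    ⟨by rw [Matrix.mul_apply, Fin.sum_univ_two, hA.1, hB.2, mul_zero, zero_mul, add_zero],
      by rw [Matrix.mul_apply, Fin.sum_univ_two, hA.2, hB.1, mul_zero, zero_mul, add_zero]⟩
  have hAdDg : ∀ A B : Matrix (Fin 2) (Fin 2) (padicAlgClResidueField p),
      GL2.IsAd A → GL2.IsDg B → GL2.IsAd (A * B) := fun A B hA hB =>
    ⟨by rw [Matrix.mul_apply, Fin.sum_univ_two, hA.1, hB.2, mul_zero, zero_mul, add_zero],
      by rw [Matrix.mul_apply, Fin.sum_univ_two, hA.2, hB.1, mul_zero, zero_mul, add_zero]⟩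
  -- the diagonal subgroup
  let Hm : Subgroup G :=
    { carrier := {g | GL2.IsDg (integralReduction (RingHom.id _) ρ₁ g).val}
      one_mem' := by
        simp only [Set.mem_setOf_eq, map_one, Units.val_one]
        exact ⟨by simp, by simp⟩
      mul_mem' := fun {x y} hx hy => by
        simp only [Set.mem_setOf_eq] at hx hy ⊢
        rw [map_mul, Units.val_mul]
        exact hDgDg _ _ hx hy
      inv_mem' := fun {x} hx => by
        simp only [Set.mem_setOf_eq] at hx ⊢
        rcases hshape x⁻¹ with h | h
        · exact h
        · exfalso
          have e : (integralReduction (RingHom.id _) ρ₁ x⁻¹).val *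
              (integralReduction (RingHom.id _) ρ₁ x).val = 1 := by
            rw [← Units.val_mul, ← map_mul, inv_mul_cancel, map_one, Units.val_one]
          have h1 := hAdDg _ _ h hx
          rw [e] at h1
          exact one_ne_zero h1.1 }
  have hmem : ∀ g, g ∈ Hm ↔ GL2.IsDg (integralReduction (RingHom.id _) ρ₁ g).val :=
    fun g => Iff.rfl
  -- some `c₀ ∉ Hm` (otherwise `e₀` would be a common eigenvector)
  have hc₀ : ∃ c₀, c₀ ∉ Hm := by
    by_contra hall
    push Not at hall
    apply hce
    refine hasCommonEigenvector_of_forall_eq_conj (ρ := integralReduction (RingHom.id _) ρ₁)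
      (hasCommonEigenvector_of_apply_one_zero_eq_zero fun g => ((hmem g).1 (hall g)).2) Q hQ
  obtain ⟨c₀, hc₀⟩ := hc₀
  -- entries of `ρ₁` vanish iff their residues do
  have hz : ∀ g (i j : Fin 2),
      (integralReduction (RingHom.id _) ρ₁ g).val i j = 0 ↔ (ρ₁ g).val i j = 0 := by
    intro g i j
    rw [integralReduction_apply_coe, RingHom.id_apply]
    constructor
    · intro h
      rcases hroots g i j with h0 | h1
      · exact h0
      · exact absurd h (residue_ne_zero_of_coe_pow_eq_one hn0.ne' h1)
    · intro h
      rw [h, map_zero]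
  refine ⟨ρ₁, Q, n, Hm, c₀, hn0, hn, hker, hQ, hroots, hshape, hc₀, fun g g' hg hg' => ?_,
    fun g hg => ?_, hmem, fun h hh => ?_, fun g hg => ?_⟩
  · rw [hmem, map_mul, Units.val_mul]
    exact hAdAd _ _ ((hshape g).resolve_left ((hmem g).not.1 hg))
      ((hshape g').resolve_left ((hmem g').not.1 hg'))
  · have h1 : ρ₁ g = 1 := by
      rw [← MonoidHom.mem_ker, hker]
      exact hg
    have e : integralReduction (RingHom.id _) ρ₁ g = 1 := by
      change Matrix.GeneralLinearGroup.map _ (ρ₁ g) = 1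
      rw [h1, map_one]
    rw [hmem, e, Units.val_one]
    exact ⟨by simp, by simp⟩
  · exact ⟨(hz h 0 1).1 ((hmem h).1 hh).1, (hz h 1 0).1 ((hmem h).1 hh).2⟩
  · have had : GL2.IsAd (integralReduction (RingHom.id _) ρ₁ g).val :=
      (hshape g).resolve_left ((hmem g).not.1 hg)
    exact ⟨(hz g 0 0).1 had.1, (hz g 1 1).1 had.2⟩

end DiagonalSubgroup

/-! ### Oddness at one complex conjugation (`p = 2`) -/

section OddOne

open Field

/-- **At `p = 2`, `det ρ₁(c) = -1` at every complex conjugation `c` at which a reduction of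
`ρ₁` is non-trivial** — the per-conjugation form of
`FramedGaloisRep.isOdd_of_isReductionOf_ne_one_two` (same proof: `ρ₁(c)` is an involution, so
`det ρ₁(c) = ±1`, and `det ρ₁(c) = 1` would force the integral model to be `±1` at `c`, both of
which reduce to `1` modulo `𝔪 ∋ 2`). [cite: Allen2014, Lemma 87 (arXiv:1301.1113, §5.1.1, p. 70)] -/
theorem FramedGaloisRep.det_eq_neg_one_of_isReductionOf_ne_one_two {K : Type*} [Field K]
    (ρ₁ : FramedGaloisRep K (PadicAlgCl 2) 2)
    {τ : absoluteGaloisGroup K →* GL (Fin 2) (padicAlgClResidueField 2)}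
    (hτ : ρ₁.IsReductionOf (RingHom.id _) τ) {φ : K →+* ℝ} {c : absoluteGaloisGroup K}
    (hcc : IsComplexConjugation φ c) (hc : τ c ≠ 1) :
    Matrix.GeneralLinearGroup.det (ρ₁ c) = -1 := by
  obtain ⟨ρ₀, Q, ⟨P, hP⟩, hQ⟩ := hτ
  have hsq : ρ₁ c * ρ₁ c = 1 := by rw [← map_mul, ← sq, hcc.sq_eq_one, map_one]
  set M : GL (Fin 2) (PadicAlgCl 2) := P⁻¹ * ρ₁ c * P with hMdef
  have hMsq : M * M = 1 := by
    rw [hMdef]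
    calc P⁻¹ * ρ₁ c * P * (P⁻¹ * ρ₁ c * P) = P⁻¹ * (ρ₁ c * ρ₁ c) * P := by group
      _ = 1 := by rw [hsq, mul_one, inv_mul_cancel]
  have hMdet : Matrix.GeneralLinearGroup.det M = Matrix.GeneralLinearGroup.det (ρ₁ c) := by
    rw [hMdef, map_mul, map_mul, map_inv, mul_right_comm, inv_mul_cancel, one_mul]
  have hdet2 : Matrix.GeneralLinearGroup.det (ρ₁ c) * Matrix.GeneralLinearGroup.det (ρ₁ c) =
      1 := by
    rw [← map_mul, hsq, map_one]
  have hd : ((Matrix.GeneralLinearGroup.det (ρ₁ c) : (PadicAlgCl 2)ˣ) : PadicAlgCl 2) = 1 ∨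
      ((Matrix.GeneralLinearGroup.det (ρ₁ c) : (PadicAlgCl 2)ˣ) : PadicAlgCl 2) = -1 := by
    apply mul_self_eq_one_iff.mp
    have h := congrArg Units.val hdet2
    rwa [Units.val_mul, Units.val_one] at h
  rcases hd with h1 | h1
  swap
  · exact Units.ext (by rw [h1, Units.val_neg, Units.val_one])
  exfalso
  have hM : ((M : GL (Fin 2) (PadicAlgCl 2)) : Matrix (Fin 2) (Fin 2) (PadicAlgCl 2)) = 1 ∨
      ((M : GL (Fin 2) (PadicAlgCl 2)) : Matrix (Fin 2) (Fin 2) (PadicAlgCl 2)) = -1 := by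
    refine eq_one_or_eq_neg_one_of_mul_self_eq_one two_ne_zero ?_ ?_
    · rw [← Matrix.GeneralLinearGroup.coe_mul, hMsq, Matrix.GeneralLinearGroup.coe_one]
    · rw [← Matrix.GeneralLinearGroup.val_det_apply, hMdet, h1]
  have hmapval : ((ρ₀ c : GL (Fin 2) (padicAlgClIntegers 2)) :
      Matrix (Fin 2) (Fin 2) (padicAlgClIntegers 2)).map (padicAlgClIntegers 2).subtype =
      ((M : GL (Fin 2) (PadicAlgCl 2)) : Matrix (Fin 2) (Fin 2) (PadicAlgCl 2)) := by
    rw [hMdef]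
    exact congrArg Units.val (hP c)
  have hinj : Function.Injective fun N : Matrix (Fin 2) (Fin 2) (padicAlgClIntegers 2) =>
      N.map (padicAlgClIntegers 2).subtype :=
    Matrix.map_injective (padicAlgClIntegers 2).subtype_injective
  have hO : ((ρ₀ c : GL (Fin 2) (padicAlgClIntegers 2)) :
      Matrix (Fin 2) (Fin 2) (padicAlgClIntegers 2)) = 1 ∨
      ((ρ₀ c : GL (Fin 2) (padicAlgClIntegers 2)) :
        Matrix (Fin 2) (Fin 2) (padicAlgClIntegers 2)) = -1 := by
    rcases hM with hM | hM
    · left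
      apply hinj
      change ((ρ₀ c : GL (Fin 2) (padicAlgClIntegers 2)) :
          Matrix (Fin 2) (Fin 2) (padicAlgClIntegers 2)).map (padicAlgClIntegers 2).subtype =
        (1 : Matrix (Fin 2) (Fin 2) (padicAlgClIntegers 2)).map (padicAlgClIntegers 2).subtype
      rw [hmapval, hM, Matrix.map_one _ (map_zero _) (map_one _)]
    · right
      apply hinj
      change ((ρ₀ c : GL (Fin 2) (padicAlgClIntegers 2)) :
          Matrix (Fin 2) (Fin 2) (padicAlgClIntegers 2)).map (padicAlgClIntegers 2).subtype =
        (-1 : Matrix (Fin 2) (Fin 2) (padicAlgClIntegers 2)).map (padicAlgClIntegers 2).subtype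
      rw [hmapval, hM, Matrix.map_neg, Matrix.map_one _ (map_zero _) (map_one _)]
      exact fun a => map_neg _ a
  have hneg : (-1 : padicAlgClResidueField 2) = 1 := by
    rw [neg_eq_iff_add_eq_zero, one_add_one_eq_two]
    exact two_eq_zero_padicAlgClResidueField_two
  have hred : integralReduction (RingHom.id _) ρ₀ c = 1 := by
    refine Units.ext (Matrix.ext fun i j => ?_)
    rw [integralReduction_apply_coe, RingHom.id_apply, Matrix.GeneralLinearGroup.coe_one]
    rcases hO with h | h
    · rw [h, Matrix.one_apply, Matrix.one_apply]
      split_ifs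
      · rw [map_one]
      · rw [map_zero]
    · rw [h, Matrix.neg_apply, Matrix.one_apply, Matrix.one_apply, map_neg]
      split_ifs
      · rw [map_one, hneg]
      · rw [map_zero, neg_zero]
  apply hc
  rw [hQ c, hred, mul_one, mul_inv_cancel]

end OddOne

/-! ### The twisted Artin representation -/

section TwistGalois

open Field

/-- A group homomorphism out of a topological group with open kernel is continuous (private
copy of the helper of `TeichmullerLiftMonomial`). [folklore] -/
private theorem continuous_of_isOpen_ker_aux₃ {G H : Type*} [Group G] [TopologicalSpace G]
    [IsTopologicalGroup G] [Group H] [TopologicalSpace H] [ContinuousMul H] (f : G →* H)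
    (hf : IsOpen (f.ker : Set G)) : Continuous f := by
  apply continuous_of_continuousAt_one f
  rw [ContinuousAt, map_one]
  intro U hU
  rw [Filter.mem_map]
  apply Filter.mem_of_superset (hf.mem_nhds (by simp))
  intro g hg
  rw [SetLike.mem_coe, MonoidHom.mem_ker] at hg
  rw [Set.mem_preimage, hg]
  exact mem_of_mem_nhds hU

variable {K : Type*} [Field K] [NumberField K]

/-- **The twist of an integral Artin representation by a locally constant character of its
diagonal subgroup** (Allen 2014, Lemma 87: "`ρ₁ = Ind χ ξ` … trivial mod `2` … a lift of `ρ̄`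
… because `ξ` is trivial at any place above `2` we have `ρ₁|_{G_v} ≅ (χ'_v 0 ; 0 χ_v)`").  Let
`ρ₀ : Γ_K → GL₂(ℤ̄_p)` have open kernel and be monomial with respect to `(Hm, c₀)` with entries
`0` or `n`-th roots of unity, and let `ξ : Γ_K → ℤ̄_p` be multiplicative on `Hm`, with
`ξ(x)^m = 1` and `ξ(x) ≡ 1 (mod 𝔪)` on `Hm`, and `= 1` on an open normal subgroup `N ≤ Hm`.
Then the twist `ρ'` (`MonomialTwist.exists_monoidHom_twist_of_monomial`) is the integral model
of a CONTINUOUS `ρ₁' : Γ_K → GL₂(ℚ̄_p)` (open kernel), has the same reduction as `ρ₀`, entries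
`0` or `(n m)`-th roots of unity, `det ρ₁'(h) = ξ(h) ξ(c₀⁻¹ h c₀) det ρ₀(h)` for `h ∈ Hm`, and
agrees with `ρ₀` on the decomposition group at every finite place `v` where `ξ` is trivial (on
`Γ_{K_v} ∩ Hm` and `c₀⁻¹ Γ_{K_v} c₀ ∩ Hm`, with `Γ_{K_v} ⊆ Hm` or `c₀ ∈ Γ_{K_v}`).
[cite: Allen2014, Lemma 87 (arXiv:1301.1113, §5.1.1, p. 70)] -/
theorem FramedGaloisRep.exists_twist_artinLift
    (ρ₀ : absoluteGaloisGroup K →* GL (Fin 2) (padicAlgClIntegers p))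
    (hopen0 : IsOpen (ρ₀.ker : Set (absoluteGaloisGroup K)))
    (Hm : Subgroup (absoluteGaloisGroup K)) (c₀ : absoluteGaloisGroup K) (hc₀ : c₀ ∉ Hm)
    (h2 : ∀ g g', g ∉ Hm → g' ∉ Hm → g * g' ∈ Hm)
    (hdg : ∀ h ∈ Hm, (ρ₀ h).val 0 1 = 0 ∧ (ρ₀ h).val 1 0 = 0)
    (had : ∀ g ∉ Hm, (ρ₀ g).val 0 0 = 0 ∧ (ρ₀ g).val 1 1 = 0)
    {n m : ℕ} (hm0 : 0 < m)
    (hroots : ∀ g i j, (ρ₀ g).val i j = 0 ∨ ((ρ₀ g).val i j : PadicAlgCl p) ^ n = 1)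
    (ξ : absoluteGaloisGroup K → padicAlgClIntegers p)
    (hξ : ∀ x ∈ Hm, ∀ y ∈ Hm, ξ (x * y) = ξ x * ξ y)
    (hξm : ∀ x ∈ Hm, (ξ x : PadicAlgCl p) ^ m = 1)
    (hξres : ∀ x ∈ Hm, residue (padicAlgClIntegers p) (ξ x) = 1)
    (hξN : ∃ N : Subgroup (absoluteGaloisGroup K), N.Normal ∧
      IsOpen (N : Set (absoluteGaloisGroup K)) ∧ ∀ g ∈ N, g ∈ Hm ∧ ξ g = 1) :
    ∃ (ρ' : absoluteGaloisGroup K →* GL (Fin 2) (padicAlgClIntegers p))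
      (ρ₁' : FramedGaloisRep K (PadicAlgCl p) 2),
      (∀ σ, Matrix.GeneralLinearGroup.map (padicAlgClIntegers p).subtype (ρ' σ) = ρ₁' σ) ∧
      IsOpen ((ρ₁' : absoluteGaloisGroup K →* GL (Fin 2) (PadicAlgCl p)).ker :
        Set (absoluteGaloisGroup K)) ∧
      (∀ h ∈ Hm, (ρ' h).val = Matrix.diagonal ![ξ h, ξ (c₀⁻¹ * h * c₀)] * (ρ₀ h).val) ∧
      (∀ g ∉ Hm, (ρ' g).val = Matrix.diagonal ![ξ (g * c₀), ξ (c₀⁻¹ * g)] * (ρ₀ g).val) ∧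
      integralReduction (RingHom.id _) ρ' = integralReduction (RingHom.id _) ρ₀ ∧
      (∀ g i j, (ρ' g).val i j = 0 ∨ ((ρ' g).val i j : PadicAlgCl p) ^ (n * m) = 1) ∧
      (∀ h ∈ Hm, ((Matrix.GeneralLinearGroup.det (ρ₁' h) : (PadicAlgCl p)ˣ) : PadicAlgCl p) =
        (ξ h : PadicAlgCl p) * (ξ (c₀⁻¹ * h * c₀) : PadicAlgCl p) *
          (((ρ₀ h).val.det : padicAlgClIntegers p) : PadicAlgCl p)) ∧
      ∀ v : HeightOneSpectrum (𝓞 K),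
        (∀ σ, absGaloisRestrict K (v.adicCompletion K) σ ∈ Hm →
          ξ (absGaloisRestrict K (v.adicCompletion K) σ) = 1) →
        (∀ σ, c₀⁻¹ * absGaloisRestrict K (v.adicCompletion K) σ * c₀ ∈ Hm →
          ξ (c₀⁻¹ * absGaloisRestrict K (v.adicCompletion K) σ * c₀) = 1) →
        ((∀ σ, absGaloisRestrict K (v.adicCompletion K) σ ∈ Hm) ∨
          ∃ σ₀, absGaloisRestrict K (v.adicCompletion K) σ₀ = c₀) →
        ρ'.comp (absGaloisRestrict K (v.adicCompletion K)).toMonoidHom =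
          ρ₀.comp (absGaloisRestrict K (v.adicCompletion K)).toMonoidHom := by
  -- unit values
  have hξu : ∀ x ∈ Hm, IsUnit (ξ x) := fun x hx => by
    refine IsUnit.of_pow_eq_one (n := m) ?_ hm0.ne'
    apply (padicAlgClIntegers p).subtype_injective
    rw [map_pow, map_one]
    exact hξm x hx
  obtain ⟨ρ', hρ, hρ'⟩ := exists_monoidHom_twist_of_monomial ρ₀ Hm c₀ hc₀ h2 hdg had ξ hξ hξu
  -- continuity: the kernel contains the open subgroup `ker ρ₀ ⊓ N`
  obtain ⟨N, hNn, hNo, hN⟩ := hξN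
  let f : absoluteGaloisGroup K →* GL (Fin 2) (PadicAlgCl p) :=
    (Matrix.GeneralLinearGroup.map (padicAlgClIntegers p).subtype).comp ρ'
  have hinj : Function.Injective
      (Matrix.GeneralLinearGroup.map (n := Fin 2) (padicAlgClIntegers p).subtype) := by
    intro A B hAB
    refine Units.ext (Matrix.ext fun i j => (padicAlgClIntegers p).subtype_injective ?_)
    have := congrArg (fun M : GL (Fin 2) (PadicAlgCl p) =>
      (M : Matrix (Fin 2) (Fin 2) (PadicAlgCl p)) i j) hAB
    simpa [Matrix.GeneralLinearGroup.map_apply] using this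
  have hle : ρ₀.ker ⊓ N ≤ f.ker := by
    intro g hg
    rw [Subgroup.mem_inf, MonoidHom.mem_ker] at hg
    obtain ⟨hgH, hgξ⟩ := hN g hg.2
    have hcg : c₀⁻¹ * g * c₀ ∈ N := hNn.conj_mem' g hg.2 c₀
    rw [MonoidHom.mem_ker]
    change Matrix.GeneralLinearGroup.map _ (ρ' g) = 1
    rw [twist_eq_one_of_mem hρ hgH hg.1 hgξ (hN _ hcg).2, map_one]
  have hopen : IsOpen (f.ker : Set (absoluteGaloisGroup K)) := by
    refine Subgroup.isOpen_mono hle ?_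
    rw [Subgroup.coe_inf]
    exact hopen0.inter hNo
  let ρ₁' : FramedGaloisRep K (PadicAlgCl p) 2 := ⟨f, continuous_of_isOpen_ker_aux₃ f hopen⟩
  refine ⟨ρ', ρ₁', fun σ => rfl, hopen, hρ, hρ', integralReduction_eq_of_twist hc₀ h2 hρ hρ' hξres,
    twist_entry_eq_zero_or_pow_eq_one hc₀ h2 hρ hρ' hroots hξm, fun h hh => ?_,
    fun v hξf hξf' hsplit => ?_⟩
  · -- determinant on `Hm`
    rw [Matrix.GeneralLinearGroup.val_det_apply]
    change ((padicAlgClIntegers p).subtype.mapMatrix (ρ' h).val).det = _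
    rw [← RingHom.map_det, det_twist_of_mem hρ hh, map_mul, map_mul]
    rfl
  · exact twist_comp_eq_of_forall_eq_one (absGaloisRestrict K (v.adicCompletion K)).toMonoidHom
      hc₀ h2 hρ hρ' hξf hξf' hsplit

end TwistGalois

/-! ### Allen's Lemma 87, Galois side, at `p = 2`, modulo the twisting character -/

section Assembly

open Field

variable {K : Type*} [Field K] [NumberField K]

/-- **Allen 2014, Lemma 87 (OrdinaryLift), the Galois side at `p = 2` — an ODD Artin lift of
`ρ̄` split on the decomposition group, modulo [Artin–Tate X Thm. 5].**  Let
`ρ : Γ_K → GL₂(ℚ̄₂)` be residually absolutely irreducible with solvable residual image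
(hypothesis (4) of the Introduction Theorem; so `ρ̄ = ρ.residualRep` is of irreducible dihedral
type), let `v` be a finite place of `K` and `Q (ρ̄|_{Γ_{K_v}}) Q⁻¹ = (χ̄'_v ∗ ; 0 χ̄_v)` a
triangular form of `ρ̄` on the decomposition group (hypothesis (2), near-ordinarity at `v ∣ 2`,
provides one: `FramedGaloisRep.IsOrdinaryOfWeightAt.hasCommonEigenvector_residualRep_comp`).
ASSUME `hAT`, the consequence of [Artin–Tate, Ch. X, Thm. 5] used by Allen: for every open
subgroup `Hm ≤ Γ_K` of index two (`Hm = G_L`) and coset representative `c₀`, there is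
`ξ : Γ_K → ℤ̄₂`, multiplicative of finite order and `≡ 1 (mod 𝔪)` on `Hm`, trivial on an open
normal subgroup inside `Hm`, with, for each real place `φ`, a complex conjugation `c` such that
`ξ(c) ξ(c₀⁻¹ c c₀) = -1` if `c ∈ Hm` ("nontrivial at each `σ_i` and trivial at each `σ'_i`";
no condition when `c ∉ Hm = G_L`, i.e. when `ρ̄(c) ≠ 1`) and trivial on
`Γ_{K_v} ∩ Hm` and `c₀⁻¹ Γ_{K_v} c₀ ∩ Hm` ("trivial at every place above `2`").  THEN there is
a continuous ODD `ρ₁ : Γ_K → GL₂(ℚ̄₂)` with integral model `ρ₀'` in the standard frame, open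
kernel, entries `0` or roots of unity, of which `ρ̄` is a reduction, and a frame
`P ∈ GL₂(ℚ̄₂)` with `P⁻¹ ρ₁|_{Γ_{K_v}} P = diag(χ'_v, χ_v)`, `χ'_v, χ_v : Γ_{K_v} → ℤ̄₂`
continuous of finite order with `χ'_v ≡ χ̄'_v`, `χ_v ≡ χ̄_v (mod 𝔪)` — "the lift `ρ₁` is
totally odd … `ρ₁|_{G_v} ≅ (χ'_v 0 ; 0 χ_v)`".
[cite: Allen2014, Lemma 87 and the preceding paragraph (arXiv:1301.1113, §5.1.1, pp. 69–70)] -/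
theorem FramedGaloisRep.exists_odd_artinLift_diagonal_of_isSolvable_two_of_exists_twistChar
    (ρ : FramedGaloisRep K (PadicAlgCl 2) 2) (hres : ρ.IsResiduallyAbsIrreducible)
    (hsol : IsSolvable ρ.residualRep.range) (v : HeightOneSpectrum (𝓞 K))
    (Qv : GL (Fin 2) (padicAlgClResidueField 2))
    (hQv : ∀ σ, (conjGL Qv (ρ.residualRep.comp
      (absGaloisRestrict K (v.adicCompletion K)).toMonoidHom) σ).val 1 0 = 0)
    (hAT : ∀ (Hm : Subgroup (absoluteGaloisGroup K)) (c₀ : absoluteGaloisGroup K),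
      IsOpen (Hm : Set (absoluteGaloisGroup K)) → c₀ ∉ Hm →
      (∀ g g', g ∉ Hm → g' ∉ Hm → g * g' ∈ Hm) →
      ∃ (ξ : absoluteGaloisGroup K → padicAlgClIntegers 2) (m : ℕ), 0 < m ∧
        (∀ x ∈ Hm, ∀ y ∈ Hm, ξ (x * y) = ξ x * ξ y) ∧
        (∀ x ∈ Hm, (ξ x : PadicAlgCl 2) ^ m = 1) ∧
        (∀ x ∈ Hm, residue (padicAlgClIntegers 2) (ξ x) = 1) ∧
        (∃ N : Subgroup (absoluteGaloisGroup K), N.Normal ∧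
          IsOpen (N : Set (absoluteGaloisGroup K)) ∧ ∀ g ∈ N, g ∈ Hm ∧ ξ g = 1) ∧
        (∀ φ : K →+* ℝ, ∃ c : absoluteGaloisGroup K, IsComplexConjugation φ c ∧
          (c ∈ Hm → (ξ c : PadicAlgCl 2) * (ξ (c₀⁻¹ * c * c₀) : PadicAlgCl 2) = -1)) ∧
        (∀ σ, absGaloisRestrict K (v.adicCompletion K) σ ∈ Hm →
          ξ (absGaloisRestrict K (v.adicCompletion K) σ) = 1) ∧
        (∀ σ, c₀⁻¹ * absGaloisRestrict K (v.adicCompletion K) σ * c₀ ∈ Hm →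
          ξ (c₀⁻¹ * absGaloisRestrict K (v.adicCompletion K) σ * c₀) = 1)) :
    ∃ (ρ₁ : FramedGaloisRep K (PadicAlgCl 2) 2)
      (ρ₀' : absoluteGaloisGroup K →* GL (Fin 2) (padicAlgClIntegers 2)) (N : ℕ), 0 < N ∧
      (∀ σ, Matrix.GeneralLinearGroup.map (padicAlgClIntegers 2).subtype (ρ₀' σ) = ρ₁ σ) ∧
      IsOpen ((ρ₁ : absoluteGaloisGroup K →* GL (Fin 2) (PadicAlgCl 2)).ker :
        Set (absoluteGaloisGroup K)) ∧
      ρ₁.IsReductionOf (RingHom.id _) ρ.residualRep ∧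
      (∀ σ i j, (ρ₀' σ).val i j = 0 ∨ ((ρ₀' σ).val i j : PadicAlgCl 2) ^ N = 1) ∧
      ρ₁.IsOdd ∧
      ∃ (P : GL (Fin 2) (PadicAlgCl 2))
        (χ₁ χ₂ : absoluteGaloisGroup (v.adicCompletion K) →* padicAlgClIntegers 2),
        (∀ σ, (P⁻¹ * ρ₁.toLocal v σ * P).val =
          Matrix.diagonal ![(χ₁ σ : PadicAlgCl 2), (χ₂ σ : PadicAlgCl 2)]) ∧
        (∀ σ, (χ₁ σ : PadicAlgCl 2) ^ (2 * N) = 1 ∧ (χ₂ σ : PadicAlgCl 2) ^ (2 * N) = 1) ∧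
        (∀ σ, residue (padicAlgClIntegers 2) (χ₁ σ) =
            (conjGL Qv (ρ.residualRep.comp
              (absGaloisRestrict K (v.adicCompletion K)).toMonoidHom) σ).val 0 0 ∧
          residue (padicAlgClIntegers 2) (χ₂ σ) =
            (conjGL Qv (ρ.residualRep.comp
              (absGaloisRestrict K (v.adicCompletion K)).toMonoidHom) σ).val 1 1) ∧
        Continuous (fun σ => (χ₁ σ : PadicAlgCl 2)) ∧
        Continuous (fun σ => (χ₂ σ : PadicAlgCl 2)) := by
  obtain ⟨hspec, hfin, hce, hdih⟩ := ρ.isDihedralType_residualRep_of_isSolvable_two hres hsol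
  haveI := hfin
  obtain ⟨ρ₀, Q, n, Hm, c₁, hn0, hn, hker, hQ, hroots, hshape, hc₁, h2, hkerle, hmem, hdg, had⟩ :=
    exists_teichmullerLift_of_isDihedralType_subgroup ρ.residualRep hce hdih
  -- the coset representative: in the decomposition group at `v` if possible
  obtain ⟨c₀, hc₀, hsplit⟩ : ∃ c₀, c₀ ∉ Hm ∧
      ((∀ σ, absGaloisRestrict K (v.adicCompletion K) σ ∈ Hm) ∨
        ∃ σ₀, absGaloisRestrict K (v.adicCompletion K) σ₀ = c₀) := by
    by_cases hall : ∀ σ, absGaloisRestrict K (v.adicCompletion K) σ ∈ Hm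
    · exact ⟨c₁, hc₁, Or.inl hall⟩
    · push Not at hall
      obtain ⟨σ₀, hσ₀⟩ := hall
      exact ⟨_, hσ₀, Or.inr ⟨σ₀, rfl⟩⟩
  -- `Hm` is open (it contains the open kernel of `ρ̄`)
  have hopenker : IsOpen (ρ.residualRep.ker : Set (absoluteGaloisGroup K)) :=
    FramedGaloisRep.isOpen_ker_of_isResidualRepOf hspec
  have hHmopen : IsOpen (Hm : Set (absoluteGaloisGroup K)) := Subgroup.isOpen_mono hkerle hopenker
  have hopen0 : IsOpen (ρ₀.ker : Set (absoluteGaloisGroup K)) := by rwa [hker]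
  -- the twisting character and the twist
  obtain ⟨ξ, m, hm0, hξ, hξm, hξres, hξN, hξodd, hξf, hξf'⟩ := hAT Hm c₀ hHmopen hc₀ h2
  obtain ⟨ρ', ρ₁, hmap, hopen, hρ, hρ', hredeq, hroots', hdet, hloc⟩ :=
    FramedGaloisRep.exists_twist_artinLift ρ₀ hopen0 Hm c₀ hc₀ h2 hdg had hm0 hroots ξ hξ hξm
      hξres hξN
  have hred1 : ρ₁.IsReductionOf (RingHom.id _) ρ.residualRep :=
    ⟨ρ', Q, ⟨1, fun σ => by rw [inv_one, one_mul, mul_one]; exact hmap σ⟩,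
      fun g => by rw [hredeq]; exact hQ g⟩
  have hNpos : 0 < n * m := Nat.mul_pos hn0 hm0
  -- oddness
  have hodd : ρ₁.IsOdd := by
    intro φ c' hcc'
    -- reduce to the complex conjugation `c` for `φ` provided by `hAT` (all are conjugate)
    obtain ⟨c, hcc, hcodd⟩ := hξodd φ
    obtain ⟨γ, hγ⟩ := isConj_iff.mp (hcc.isConj hcc')
    rw [← hγ, map_mul, map_mul, map_inv, map_mul, map_mul, map_inv,
      mul_comm (Matrix.GeneralLinearGroup.det (ρ₁ γ)) (Matrix.GeneralLinearGroup.det (ρ₁ c)),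
      mul_inv_cancel_right]
    by_cases hc : c ∈ Hm
    · -- `c ∈ G_L`: `ρ₀(c) = 1`, and `det ρ₁(c) = ξ(c) ξ(c₀⁻¹ c c₀) = -1`
      have hc2 : ρ₀ c * ρ₀ c = 1 := by rw [← map_mul, ← sq, hcc.sq_eq_one, map_one]
      obtain ⟨h01, h10⟩ := hdg c hc
      have hdetO : (ρ₀ c).val 0 0 * (ρ₀ c).val 1 1 ≠ 0 := by
        intro h0
        have hu := (ρ₀ c).isUnit.map Matrix.detMonoidHom
        rw [Matrix.coe_detMonoidHom, Matrix.det_fin_two, h01, zero_mul, sub_zero, h0] at hu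
        exact not_isUnit_zero hu
      have hsq0 : ((ρ₀ c).val 0 0 : PadicAlgCl 2) ^ 2 = 1 := by
        have e := congrArg (fun M : GL (Fin 2) (padicAlgClIntegers 2) =>
          (M.val 0 0 : PadicAlgCl 2)) hc2
        simp only [Units.val_mul, Units.val_one, Matrix.mul_apply, Fin.sum_univ_two, h01,
          zero_mul, add_zero, Matrix.one_apply_eq, OneMemClass.coe_one, MulMemClass.coe_mul] at e
        rw [pow_two]
        exact e
      have hsq1 : ((ρ₀ c).val 1 1 : PadicAlgCl 2) ^ 2 = 1 := by
        have e := congrArg (fun M : GL (Fin 2) (padicAlgClIntegers 2) =>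
          (M.val 1 1 : PadicAlgCl 2)) hc2
        simp only [Units.val_mul, Units.val_one, Matrix.mul_apply, Fin.sum_univ_two, h10,
          zero_mul, zero_add, Matrix.one_apply_eq, OneMemClass.coe_one, MulMemClass.coe_mul] at e
        rw [pow_two]
        exact e
      have hg2 : n.gcd 2 = 1 := ((Nat.Prime.coprime_iff_not_dvd Nat.prime_two).2 hn).symm
      have hone0 : ((ρ₀ c).val 0 0 : PadicAlgCl 2) = 1 := by
        have hni : ((ρ₀ c).val 0 0 : PadicAlgCl 2) ^ n = 1 :=
          (hroots c 0 0).resolve_left fun h0 => hdetO (by rw [h0, zero_mul])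
        have h := (pow_gcd_eq_one (m := n) (n := 2)).mpr ⟨hni, hsq0⟩
        rwa [hg2, pow_one] at h
      have hone1 : ((ρ₀ c).val 1 1 : PadicAlgCl 2) = 1 := by
        have hni : ((ρ₀ c).val 1 1 : PadicAlgCl 2) ^ n = 1 :=
          (hroots c 1 1).resolve_left fun h0 => hdetO (by rw [h0, mul_zero])
        have h := (pow_gcd_eq_one (m := n) (n := 2)).mpr ⟨hni, hsq1⟩
        rwa [hg2, pow_one] at h
      have hdet1 : (((ρ₀ c).val.det : padicAlgClIntegers 2) : PadicAlgCl 2) = 1 := by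
        rw [Matrix.det_fin_two, h01, zero_mul, sub_zero, MulMemClass.coe_mul, hone0, hone1,
          mul_one]
      refine Units.ext ?_
      rw [hdet c hc, hdet1, mul_one, hcodd hc, Units.val_neg, Units.val_one]
    · -- `c ∉ G_L`: `ρ̄(c) ≠ 1` and the involution argument
      refine ρ₁.det_eq_neg_one_of_isReductionOf_ne_one_two hred1 hcc fun h1 => ?_
      have had' : GL2.IsAd (integralReduction (RingHom.id _) ρ₀ c).val :=
        (hshape c).resolve_left ((hmem c).not.1 hc)
      have e : integralReduction (RingHom.id _) ρ₀ c = 1 := by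
        have h := hQ c
        rw [h1] at h
        -- `1 = Q * red c * Q⁻¹`
        calc integralReduction (RingHom.id _) ρ₀ c
            = Q⁻¹ * (Q * integralReduction (RingHom.id _) ρ₀ c * Q⁻¹) * Q := by group
          _ = 1 := by rw [← h, mul_one, inv_mul_cancel]
      have h00 := had'.1
      rw [e, Units.val_one, Matrix.one_apply_eq] at h00
      exact one_ne_zero h00
  -- the local shape: the twist agrees with `ρ₀` on `Γ_{K_v}`, where Theorem A applies
  have hcomp := hloc v hξf hξf' hsplit
  have hconj : ∀ σ,
      conjGL (Qv * Q) ((integralReduction (RingHom.id _) ρ₀).comp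
        (absGaloisRestrict K (v.adicCompletion K)).toMonoidHom) σ =
      conjGL Qv (ρ.residualRep.comp (absGaloisRestrict K (v.adicCompletion K)).toMonoidHom) σ := by
    intro σ
    rw [conjGL_apply, conjGL_apply, MonoidHom.comp_apply, MonoidHom.comp_apply, hQ]
    group
  have hQ' : ∀ σ, (conjGL (Qv * Q) ((integralReduction (RingHom.id _) ρ₀).comp
      (absGaloisRestrict K (v.adicCompletion K)).toMonoidHom) σ).val 1 0 = 0 := fun σ => by
    rw [hconj σ]
    exact hQv σ
  obtain ⟨P, χ₁, χ₂, hdiag, hpow, hresid⟩ := exists_conjGL_diagonal_comp_of_monomial hn0 hn ρ₀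
    hroots hshape (absGaloisRestrict K (v.adicCompletion K)).toMonoidHom (Qv * Q) hQ'
  have hloc₁ : ∀ σ, ρ₁.toLocal v σ =
      Matrix.GeneralLinearGroup.map (padicAlgClIntegers 2).subtype
        (ρ₀ ((absGaloisRestrict K (v.adicCompletion K)).toMonoidHom σ)) := by
    intro σ
    rw [FramedGaloisRep.toLocal_apply, ← hmap]
    have e := congrArg (fun ψ : absoluteGaloisGroup (v.adicCompletion K) →*
      GL (Fin 2) (padicAlgClIntegers 2) => ψ σ) hcomp
    simp only [MonoidHom.comp_apply] at e
    rw [← e]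
    rfl
  have hdiag' : ∀ σ, (P⁻¹ * ρ₁.toLocal v σ * P).val =
      Matrix.diagonal ![(χ₁ σ : PadicAlgCl 2), (χ₂ σ : PadicAlgCl 2)] := fun σ => by
    rw [hloc₁ σ]
    exact hdiag σ
  have hcont : Continuous fun σ => (P⁻¹ * ρ₁.toLocal v σ * P).val :=
    Units.continuous_val.comp
      ((continuous_const.mul (map_continuous (ρ₁.toLocal v))).mul continuous_const)
  refine ⟨ρ₁, ρ', n * m, hNpos, hmap, hopen, hred1, hroots', hodd, P, χ₁, χ₂, hdiag',
    fun σ => ?_, fun σ => ?_, ?_, ?_⟩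
  · obtain ⟨h1, h2'⟩ := hpow σ
    refine ⟨?_, ?_⟩
    · rw [show 2 * (n * m) = 2 * n * m by ring, pow_mul, h1, one_pow]
    · rw [show 2 * (n * m) = 2 * n * m by ring, pow_mul, h2', one_pow]
  · rw [← hconj σ]
    exact hresid σ
  · refine (hcont.matrix_elem 0 0).congr fun σ => ?_
    rw [hdiag' σ]
    simp [Matrix.diagonal]
  · refine (hcont.matrix_elem 1 1).congr fun σ => ?_
    rw [hdiag' σ]
    simp [Matrix.diagonal]

end Assembly

end Literature.NumberTheory.GaloisRepresentations

end
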